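import Summits.AtomisticToContinuum.Crystallization.Theorems.FluxTubeKeplerFluxCellKeplerSingleScale
import Summits.AtomisticToContinuum.Crystallization.Theorems.ChessboardParticlePlanesPeriodicWindowsIffCrystallization

/-!
# F4 on-path lemma for the forward rung `CompetitorBlindRung`: `Crystallization → CompetitorBlindRung`

The sub-problem statement gives every member of the periodic-competitor family, whatever the complexity
`(m, L, ρ)`: by the landed `periodicWindows_of_crystallization`
(Theorems/ChessboardParticlePlanesPeriodicWindowsIffCrystallization) every ground-state sequence has
periodic windows, which is the conclusion of `CompRung m L ρ` with its FLOOR and BUDGET hypotheses unused.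
Hence `CompetitorBlindRung` follows from `Crystallization`; tagged `@[aesop safe apply]` for the kernel's
on-path battery.  Self-contained copy (sub-namespace `OnPath`) of the definitions of
`Lines/CompetitorBlindRung.lean`; the canonical `CompetitorLadder.CompetitorBlindRung_of_Crystallization`
lives there with the same text.  No `sorry`.  ([nec]-trap guard: the rung is a consequence of S, pinned at
the other end to the proved floor by the F3 witness `Lines/CompetitorBlindRung_special.lean`.)
-/

noncomputable section

namespace Summit.AtomisticToContinuum.Crystallization.Cruxes.FluxCellKepler.CompetitorLadder.OnPath

open Filter Topology
open Literature.MathematicalPhysics.StatisticalMechanics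
open Summit.AtomisticToContinuum.Crystallization.Theorems.FluxCellKeplerSingleScale (LayeredGood)

local notation "E3" => EuclideanSpace ℝ (Fin 3)

/-! ## Definitions -/

/-- FLOOR(P₀): `N·e(P₀) ≤ E(x)` for every Lennard-Jones ground state `x` (verbatim the first hypothesis
of `FluxTubeKepler.FloorGivesLayered`). -/
def Floor (P₀ : PeriodicConfiguration 3) : Prop :=
  ∀ (N : ℕ) (x : Fin N → E3), IsGroundState lennardJones x →
    (N : ℝ) * P₀.energyPerParticle lennardJones ≤ interactionEnergy lennardJones x

/-- The point set `F + ℤb₀ + ℤb₁ + ℤb₂` generated by a CELL DATUM `(b, F)` (cell basis `b`, motif `F`). -/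
def cellSet (b : Fin 3 → E3) (F : Finset E3) : Set E3 :=
  {p | ∃ y ∈ F, ∃ n : Fin 3 → ℤ, p = y + ∑ k, (n k : ℝ) • b k}

/-- ADMISSIBLE CELL DATA of complexity `(m, L, ρ)`: `b` linearly independent with `‖b k‖ ≤ L`, a
non-empty motif of at most `m` points of norm `≤ 3L`, pairwise inequivalent modulo `ℤb`, and the generated
point set `ρ`-separated.  (Every periodic point set with `≤ m` points per cell, a cell basis of norms `≤ L`
and separation `ρ` is `cellSet b F` for such a datum: reduce the motif into the cell.) -/
def IsCell (m : ℕ) (L ρ : ℝ) (b : Fin 3 → E3) (F : Finset E3) : Prop :=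
  LinearIndependent ℝ b ∧ (∀ k, ‖b k‖ ≤ L) ∧ F.Nonempty ∧ F.card ≤ m ∧ (∀ y ∈ F, ‖y‖ ≤ 3 * L) ∧
    (∀ y ∈ F, ∀ y' ∈ F, (∃ n : Fin 3 → ℤ, y - y' = ∑ k, (n k : ℝ) • b k) → y = y') ∧
    (∀ p ∈ cellSet b F, ∀ q ∈ cellSet b F, p ≠ q → ρ ≤ dist p q)

/-- Site `i` of `x` is `(R, η)`-PERIODIC-GOOD at complexity `(m, L, ρ)`: the relative positions
`x j − x i` are two-way `η`-matched on the `R`-ball with the point set of an admissible cell datum. -/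
def PerGood (m : ℕ) (L ρ R η : ℝ) {N : ℕ} (x : Fin N → E3) (i : Fin N) : Prop :=
  ∃ (b : Fin 3 → E3) (F : Finset E3), IsCell m L ρ b F ∧
    (∀ p ∈ cellSet b F, ‖p‖ ≤ R → ∃ j : Fin N, dist (x j - x i) p ≤ η) ∧
    (∀ j : Fin N, ‖x j - x i‖ ≤ R → ∃ p ∈ cellSet b F, dist (x j - x i) p ≤ η)

/-- COMPETITOR-BLIND BUDGET(P₀) at complexity `(m, L, ρ)`: at scale `(R, η)` only the sites that are
NEITHER layered-good NOR periodic-good are priced (the crux's quantifier order `∀ R η ∃ c`). -/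
def Budget (m : ℕ) (L ρ : ℝ) (P₀ : PeriodicConfiguration 3) : Prop :=
  ∀ R η : ℝ, 0 < R → 0 < η → ∃ c : ℝ, 0 < c ∧
    ∀ (N : ℕ) (x : Fin N → E3), IsGroundState lennardJones x →
      c * (Nat.card {i : Fin N // ¬ (LayeredGood R η x i ∨ PerGood m L ρ R η x i)} : ℝ) ≤
        interactionEnergy lennardJones x - (N : ℝ) * P₀.energyPerParticle lennardJones

/-- Periodic windows along `x` (verbatim the conclusion of `ChessboardParticlePlanes.PeriodicWindows`). -/
def HasPeriodicWindows (x : (N : ℕ) → (Fin N → E3)) : Prop :=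
  ∃ P : PeriodicConfiguration 3, ∀ R ε : ℝ, 0 < ε → ∃ᶠ N in atTop, ∃ t : E3,
    (∀ s ∈ P.points, ‖s‖ ≤ R → ∃ i : Fin N, dist (x N i + t) s ≤ ε) ∧
    (∀ i : Fin N, ‖x N i + t‖ ≤ R → ∃ s ∈ P.points, dist (x N i + t) s ≤ ε)

/-- The graded family: FLOOR + the competitor-blind budget of complexity `(m, L, ρ)` force periodic
windows along every Lennard-Jones ground-state sequence. -/
def CompRung (m : ℕ) (L ρ : ℝ) : Prop :=
  ∀ P₀ : PeriodicConfiguration 3, Floor P₀ → Budget m L ρ P₀ →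
    ∀ x : (N : ℕ) → (Fin N → E3), (∀ N, IsGroundState lennardJones (x N)) → HasPeriodicWindows x

/-- **The deciding rung** (top of the family): periodic competitors of EVERY bounded complexity go
un-priced, and Lennard-Jones ground states still have periodic windows. -/
def CompetitorBlindRung : Prop := ∀ (m : ℕ) (L ρ : ℝ), 0 < ρ → CompRung m L ρ

/-! ## F4 — on path: `Crystallization → CompetitorBlindRung` -/

/-- Every member of the family follows from the sub-problem (landed `periodicWindows_of_crystallization`):
its FLOOR and BUDGET hypotheses are simply not used. [folklore] -/
theorem compRung_of_crystallization (m : ℕ) (L ρ : ℝ) (h : _root_.Crystallization) : CompRung m L ρ :=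
  fun _ _ _ x hx =>
    (Theorems.ChessboardParticlePlanesPeriodicWindowsIffCrystallization.periodicWindows_of_crystallization
      h) x hx

/-- **F4 (on path).** `Crystallization → CompetitorBlindRung`. [folklore] -/
@[aesop safe apply]
theorem CompetitorBlindRung_of_Crystallization (h : _root_.Crystallization) : CompetitorBlindRung :=
  fun m L ρ _ => compRung_of_crystallization m L ρ h


end Summit.AtomisticToContinuum.Crystallization.Cruxes.FluxCellKepler.CompetitorLadder.OnPath

end
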